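import Summits.AtomisticToContinuum.BoseEinsteinCondensation.Theorems.BECThomsonPrincipleDensityResponseKineticSignCoherence
import Summits.AtomisticToContinuum.BoseEinsteinCondensation.Theorems.BECThomsonPrincipleDensityResponseTransportStationary

/-!
# Route `BECThomsonPrinciple`, crux `DensityResponse` (stmt-AtomisticToContinuum-9481),
# line `force-balance-constitutive` — the composition: crux ⇐ constitutive core ∧ truncation limit

The kernel-checked composition of the line's registered skeleton
(`Cruxes/DensityResponse/Lines/force-balance-constitutive.lean`), landed now that three of its five stubs are theorems
of the tree (S1 `stub_transportStationary` — `…TransportStationary.lean`; S3a/S3b `stub_kineticSignCoherence{Bounded,Unbounded}`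
— `…KineticSignCoherence.lean`):

* `real_chord` — the closing real algebra: from the transport-stationary normal form (`hdrive`, `hstat`), `N_eff ≤ 2N`,
  `|m| ≤ 2N` and the two regime inequalities (constitutive core for `s ≤ ρa`, kinetic sign-coherence for `s ≥ ρa`, each on
  sub-ground positively modulated states) the chord `E₀ − C s²N/(k∞² + ρa) ≤ E(Φ) − s|m|` with
  `C = max(4(2+C₁)/min(1,4κ), 8(2+C′), 4)`;
* `body_of_ineqs` — S1 + S4 + `CoreIneq`/`KinIneq` for the truncations `v_t`, `t ≥ t₀`, give the crux body for `(v, M)`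
  (ε-argument over the truncation height, `ℝ≥0∞` dress);
* `DensityResponse_of : S1 → S2 → S3a → S3b → S4 → DensityResponse` (split on boundedness of `v`);
* `stub_reduction : ConstitutiveCore → TruncationLimit → DensityResponse` — the registered sub-goal this file lands with:
  **the crux is closed modulo S2 and S4**.
-/

namespace Summit.AtomisticToContinuum.BoseEinsteinCondensation.Cruxes.DensityResponse.ForceBalanceConstitutive

open MeasureTheory
open scoped ENNReal
open Literature.MathematicalPhysics.QuantumManyBody.BoseGas
open Summit.AtomisticToContinuum.BoseEinsteinCondensation.Theses

noncomputable section

/-! ### The kernel-checked composition -/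

/-- **The closing algebra (pure real arithmetic).** From the normal form (`hdrive`, `hstat`), `N_eff ≤ 2N`,
`|m| ≤ 2N`, and the two regime inequalities — the constitutive core for `s ≤ ρa` and kinetic sign-coherence for
`s ≥ ρa`, each only on sub-ground positively-modulated states — the chord `E₀ - C s² N/(k∞² + ρa) ≤ E(Φ) - s|m|`
with `C ≥ max(4(2+C₁)/θ, 8(2+C′), 4)`, `θ = min(1, 4κ)`. Cases: `m' < 0` or not sub-ground (trivial); `s ≤ ρa`
(core: `m'(q + 4κρa) ≤ 4(2+C₁)sN`, `θ(k∞² + ρa) ≤ q + 4κρa`); `ρa < s`, `ρa ≤ k∞²` (kinetic: `m'q ≤ 4(2+C′)sN`,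
`k∞² + ρa ≤ 2q`); `k∞² < ρa < s` (trivial: `s|m| ≤ 2sN ≤ 4s²N/(k∞²+ρa)`). -/
theorem real_chord {E₀w E' EwΦ m m' s K I q Nf qs ρa κ C₁ C' θ C Nr : ℝ}
    (hs : 0 ≤ s) (hNr : 0 ≤ Nr) (hqs0 : 0 < qs) (hρa0 : 0 ≤ ρa) (hq : qs ≤ q)
    (hθpos : 0 < θ) (hθ1 : θ ≤ 1) (hθκ : θ ≤ 4 * κ)
    (hC4 : 4 ≤ C) (hCcore : 4 * (2 + C₁) / θ ≤ C) (hCkin : 8 * (2 + C') ≤ C)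
    (habs : |m| ≤ 2 * Nr) (hNf : Nf ≤ 2 * Nr)
    (hE₀E' : E₀w ≤ E') (hE₀Ew : E₀w ≤ EwΦ)
    (hdrive : E' - s * m' ≤ EwΦ - s * |m|)
    (hstat : K + q / 4 * m' + I = s * Nf)
    (hcore : s ≤ ρa → E' - s * m' ≤ E₀w → 0 ≤ m' → κ * ρa * m' ≤ K + I + C₁ * s * Nr)
    (hkin : ρa ≤ s → E' - s * m' ≤ E₀w → -(C' * s * Nr) ≤ K + I) :
    E₀w - C * s ^ 2 * Nr / (qs + ρa) ≤ EwΦ - s * |m| := by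
  have hden : 0 < qs + ρa := by positivity
  have hC0 : 0 ≤ C := by linarith
  have hT0 : 0 ≤ C * s ^ 2 * Nr / (qs + ρa) := by positivity
  have hsNf : s * Nf ≤ s * (2 * Nr) := mul_le_mul_of_nonneg_left hNf hs
  -- the chord from a linear-response bound `m' (k∞² + ρa) ≤ C s N`
  have chord_of_lr : 0 ≤ m' → m' * (qs + ρa) ≤ C * s * Nr →
      E₀w - C * s ^ 2 * Nr / (qs + ρa) ≤ EwΦ - s * |m| := by
    intro hnn h4
    have h5 : s * m' ≤ C * s ^ 2 * Nr / (qs + ρa) := by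
      rw [le_div_iff₀ hden]
      nlinarith [mul_le_mul_of_nonneg_left h4 hs]
    linarith
  -- negatively modulated normal form: trivial
  rcases lt_or_ge m' 0 with hneg | hnn
  · have : s * m' ≤ 0 := by nlinarith
    linarith
  -- normal form not sub-ground: trivial
  rcases lt_or_ge E₀w (E' - s * m') with hsup | hsub
  · linarith
  rcases le_or_gt s ρa with hsmall | hlarge
  · -- sub-healing drive: the constitutive core
    have hci := hcore hsmall hsub hnn
    have h1 : m' * (q + 4 * (κ * ρa)) ≤ 4 * (2 + C₁) * s * Nr := by nlinarith
    have hθden : θ * (qs + ρa) ≤ q + 4 * (κ * ρa) := by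
      have e1 : θ * qs ≤ q := (mul_le_of_le_one_left hqs0.le hθ1).trans hq
      have e2 : θ * ρa ≤ 4 * κ * ρa := mul_le_mul_of_nonneg_right hθκ hρa0
      nlinarith
    have h3 : m' * (qs + ρa) * θ ≤ 4 * (2 + C₁) * (s * Nr) := by
      calc m' * (qs + ρa) * θ = m' * (θ * (qs + ρa)) := by ring
        _ ≤ m' * (q + 4 * (κ * ρa)) := mul_le_mul_of_nonneg_left hθden hnn
        _ ≤ 4 * (2 + C₁) * s * Nr := h1
        _ = 4 * (2 + C₁) * (s * Nr) := by ring
    have h4 : m' * (qs + ρa) ≤ C * s * Nr := by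
      have h3' : m' * (qs + ρa) ≤ 4 * (2 + C₁) / θ * (s * Nr) := by
        rw [div_mul_eq_mul_div, le_div_iff₀ hθpos]
        exact h3
      calc m' * (qs + ρa) ≤ 4 * (2 + C₁) / θ * (s * Nr) := h3'
        _ ≤ C * (s * Nr) := mul_le_mul_of_nonneg_right hCcore (mul_nonneg hs hNr)
        _ = C * s * Nr := by ring
    exact chord_of_lr hnn h4
  · rcases le_or_gt ρa qs with hUV | hIR
    · -- super-healing drive on the UV half: kinetic sign-coherence
      have hk := hkin hlarge.le hsub
      have h1 : m' * q ≤ 4 * (2 + C') * s * Nr := by nlinarith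
      have h4 : m' * (qs + ρa) ≤ C * s * Nr := by
        have hd2 : qs + ρa ≤ 2 * q := by linarith
        calc m' * (qs + ρa) ≤ m' * (2 * q) := mul_le_mul_of_nonneg_left hd2 hnn
          _ = 2 * (m' * q) := by ring
          _ ≤ 2 * (4 * (2 + C') * s * Nr) := by linarith
          _ = 8 * (2 + C') * (s * Nr) := by ring
          _ ≤ C * (s * Nr) := mul_le_mul_of_nonneg_right hCkin (mul_nonneg hs hNr)
          _ = C * s * Nr := by ring
      exact chord_of_lr hnn h4
    · -- `k∞² < ρa < s`: the chord is trivial (`|m| ≤ 2N`)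
      have hd2 : qs + ρa ≤ 2 * s := by linarith
      have h5 : s * |m| ≤ C * s ^ 2 * Nr / (qs + ρa) := by
        rw [le_div_iff₀ hden]
        have e1 : s * |m| * (qs + ρa) ≤ s * (2 * Nr) * (2 * s) :=
          mul_le_mul (mul_le_mul_of_nonneg_left habs hs) hd2 hden.le (by positivity)
        have e2 : 4 * (s ^ 2 * Nr) ≤ C * (s ^ 2 * Nr) := mul_le_mul_of_nonneg_right hC4 (by positivity)
        nlinarith [e1, e2]
      linarith

/-- **The composition, inner form**: S1, S4 and the two regime inequalities — `CoreIneq` and `KinIneq` for the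
truncations `v_t`, `t ≥ t₀`, with the envelope's scattering length — give the crux's body for `(v, M)`:
`C := max(4(2+C₁)/min(1,4κ), 8(2+C′), 4)`, `ρ₀ := min`, `N₀ := max`. For data `(N, L, n, s, Φ)` with
`E_v(Φ) < ∞` the real chord `E₀(v) - T ≤ E_v(Φ) - s|m|`, `T = Cs²N/(k∞²+ρa)`, is proved up to every `ε > 0`
through the truncation `v_t`, `t = max(t₀, t₀′, t₁(ε))`: S1 gives a transport-stationary `Φ'` for `v_t`,
`real_chord` (fed by the two inequalities at `Φ'`) gives the chord for `v_t`, then `E_{v_t} ≤ E_v`, S4 and the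
`ℝ≥0∞` dress finish. -/
theorem body_of_ineqs (h₁ : TransportStationary) (h₄ : TruncationLimit) {v : ℝ → ℝ≥0∞}
    (hv : IsRepulsiveFiniteRange v) {M ρ₂ κ C₁ ρ₃ C' : ℝ} (hρ₂ : 0 < ρ₂) (hκ : 0 < κ) (hρ₃ : 0 < ρ₃)
    {N₂ t₂ N₃ t₃ : ℕ}
    (hcore : ∀ t : ℕ, t₂ ≤ t → CoreIneq (truncPotential v t) (scatteringLength v).toReal M ρ₂ κ C₁ N₂)
    (hkin : ∀ t : ℕ, t₃ ≤ t → KinIneq (truncPotential v t) (scatteringLength v).toReal M ρ₃ C' N₃) :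
    ∃ ρ₀ C : ℝ, 0 < ρ₀ ∧ 0 < C ∧ ∃ N₀ : ℕ, ∀ N : ℕ, N₀ ≤ N → ∀ L : ℝ, 0 < L → (N : ℝ) ≤ ρ₀ * L ^ 3 →
      ∀ n : Fin 3 → ℤ, n ≠ 0 → 2 * Real.pi * ‖(fun j => (n j : ℝ))‖ / L ≤ M * Real.sqrt (N / L ^ 3) →
      ∀ s : ℝ, 0 ≤ s → ∀ Φ : PeriodicTrialState N L,
        periodicGroundStateEnergy v N L + ENNReal.ofReal (s * |∫ X in cellN N L,
            (∑ i, 2 * Real.cos (2 * Real.pi / L * ∑ j, (n j : ℝ) * X i j)) * ‖Φ.ψ X‖ ^ 2|)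
          ≤ periodicEnergy v Φ + ENNReal.ofReal (C * s ^ 2 * N /
              ((2 * Real.pi * ‖(fun j => (n j : ℝ))‖ / L) ^ 2 + N / L ^ 3 * (scatteringLength v).toReal)) := by
  -- constants
  have hθpos : 0 < min 1 (4 * κ) := lt_min one_pos (by linarith)
  have hθ1 : min 1 (4 * κ) ≤ 1 := min_le_left _ _
  have hθκ : min 1 (4 * κ) ≤ 4 * κ := min_le_right _ _
  have hC4 : (4 : ℝ) ≤ max (max (4 * (2 + C₁) / min 1 (4 * κ)) (8 * (2 + C'))) 4 := le_max_right _ _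
  have hCcoreC : 4 * (2 + C₁) / min 1 (4 * κ) ≤ max (max (4 * (2 + C₁) / min 1 (4 * κ)) (8 * (2 + C'))) 4 :=
    (le_max_left _ _).trans (le_max_left _ _)
  have hCkinC : 8 * (2 + C') ≤ max (max (4 * (2 + C₁) / min 1 (4 * κ)) (8 * (2 + C'))) 4 :=
    (le_max_right _ _).trans (le_max_left _ _)
  refine ⟨min ρ₂ ρ₃, max (max (4 * (2 + C₁) / min 1 (4 * κ)) (8 * (2 + C'))) 4, lt_min hρ₂ hρ₃,
    lt_of_lt_of_le (by norm_num) hC4, max N₂ N₃, ?_⟩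
  generalize max (max (4 * (2 + C₁) / min 1 (4 * κ)) (8 * (2 + C'))) 4 = C at hC4 hCcoreC hCkinC
  intro N hN L hL hNL n hn hwin s hs Φ
  change periodicGroundStateEnergy v N L + ENNReal.ofReal (s * |sourceMean n Φ|) ≤
    periodicEnergy v Φ + ENNReal.ofReal (C * s ^ 2 * N /
      ((2 * Real.pi * ‖(fun j => (n j : ℝ))‖ / L) ^ 2 + N / L ^ 3 * (scatteringLength v).toReal))
  have hN₂ : N₂ ≤ N := (le_max_left _ _).trans hN
  have hN₃ : N₃ ≤ N := (le_max_right _ _).trans hN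
  have hL3 : (0 : ℝ) ≤ L ^ 3 := by positivity
  have hNL₂ : (N : ℝ) ≤ ρ₂ * L ^ 3 := hNL.trans (mul_le_mul_of_nonneg_right (min_le_left _ _) hL3)
  have hNL₃ : (N : ℝ) ≤ ρ₃ * L ^ 3 := hNL.trans (mul_le_mul_of_nonneg_right (min_le_right _ _) hL3)
  -- signs
  have hNnn : (0 : ℝ) ≤ N := Nat.cast_nonneg N
  have hρa0 : 0 ≤ (N : ℝ) / L ^ 3 * (scatteringLength v).toReal := by positivity
  have hnR : (fun j => (n j : ℝ)) ≠ 0 := by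
    intro h0
    apply hn
    funext j
    have h1 : (n j : ℝ) = 0 := by simpa using congrFun h0 j
    show n j = 0
    exact_mod_cast h1
  have hqs0 : 0 < (2 * Real.pi * ‖(fun j => (n j : ℝ))‖ / L) ^ 2 := by
    have := norm_pos_iff.mpr hnR
    positivity
  have hT0 : 0 ≤ C * s ^ 2 * N /
      ((2 * Real.pi * ‖(fun j => (n j : ℝ))‖ / L) ^ 2 + N / L ^ 3 * (scatteringLength v).toReal) := by
    have : (0 : ℝ) ≤ C := by linarith
    positivity
  have habs : |sourceMean n Φ| ≤ 2 * N := abs_sourceMean_le n Φ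
  have hq : (2 * Real.pi * ‖(fun j => (n j : ℝ))‖ / L) ^ 2 ≤ ksq L n := ksupSq_le_ksq L n
  -- infinite energy: nothing to prove
  by_cases hE : periodicEnergy v Φ = ⊤
  · rw [hE, top_add]; exact le_top
  have hE₀ : periodicGroundStateEnergy v N L ≠ ⊤ :=
    ne_top_of_le_ne_top hE (periodicGroundStateEnergy_le v Φ)
  -- the real chord suffices
  suffices hreal : (periodicGroundStateEnergy v N L).toReal - C * s ^ 2 * N /
      ((2 * Real.pi * ‖(fun j => (n j : ℝ))‖ / L) ^ 2 + N / L ^ 3 * (scatteringLength v).toReal) ≤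
      (periodicEnergy v Φ).toReal - s * |sourceMean n Φ| by
    rw [(ENNReal.ofReal_toReal hE₀).symm, (ENNReal.ofReal_toReal hE).symm,
      ← ENNReal.ofReal_add ENNReal.toReal_nonneg (by positivity),
      ← ENNReal.ofReal_add ENNReal.toReal_nonneg hT0]
    exact ENNReal.ofReal_le_ofReal (by linarith)
  -- … and it is proved up to every `ε > 0` through a tall truncation of `v`
  refine le_of_forall_pos_le_add fun ε hε => ?_
  obtain ⟨t₁, ht₁⟩ := h₄ v hv N L hL hE₀ ε hε
  obtain ⟨t, ht₂, ht₃, htt₁⟩ : ∃ t : ℕ, t₂ ≤ t ∧ t₃ ≤ t ∧ t₁ ≤ t :=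
    ⟨max (max t₂ t₃) t₁, (le_max_left _ _).trans (le_max_left _ _),
      (le_max_right _ _).trans (le_max_left _ _), le_max_right _ _⟩
  have hw : IsRepulsiveFiniteRange (truncPotential v t) := isRepulsiveFiniteRange_truncPotential hv t
  have hwb : ∃ B : ℝ, ∀ r, truncPotential v t r ≤ ENNReal.ofReal B := ⟨t, truncPotential_le_ofReal v t⟩
  have hEwΦ_le : periodicEnergy (truncPotential v t) Φ ≤ periodicEnergy v Φ :=
    periodicEnergy_truncPotential_le v t Φ
  have hEwΦ : periodicEnergy (truncPotential v t) Φ ≠ ⊤ := ne_top_of_le_ne_top hE hEwΦ_le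
  have hEwΦr : (periodicEnergy (truncPotential v t) Φ).toReal ≤ (periodicEnergy v Φ).toReal :=
    ENNReal.toReal_mono hE hEwΦ_le
  have hE₀wr : (periodicGroundStateEnergy (truncPotential v t) N L).toReal ≤
      (periodicEnergy (truncPotential v t) Φ).toReal :=
    ENNReal.toReal_mono hEwΦ (periodicGroundStateEnergy_le _ Φ)
  have hlim : (periodicGroundStateEnergy v N L).toReal ≤
      (periodicGroundStateEnergy (truncPotential v t) N L).toReal + ε := ht₁ t htt₁
  -- S1: the transport-stationary normal form for the truncated potential
  obtain ⟨Φ', hE', hdrive, hstat⟩ := h₁ N L (truncPotential v t) hw hwb hL n hn s hs Φ hEwΦ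
  have hE₀E' : (periodicGroundStateEnergy (truncPotential v t) N L).toReal ≤
      (periodicEnergy (truncPotential v t) Φ').toReal :=
    ENNReal.toReal_mono hE' (periodicGroundStateEnergy_le _ Φ')
  have hstat' : kineticStressWave n Φ' + ksq L n / 4 * sourceMean n Φ' + virialWave (truncPotential v t) n Φ' =
      s * effNumber n Φ' := hstat
  -- the chord for the truncated potential (closing algebra fed by the two regime inequalities at `Φ'`)
  have key := real_chord hs hNnn hqs0 hρa0 hq hθpos hθ1 hθκ hC4 hCcoreC hCkinC habs (effNumber_le n Φ')
    hE₀E' hE₀wr hdrive hstat'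
    (fun hsmall hsub hnn => hcore t ht₂ N hN₂ L hL hNL₂ n hn hwin s hs hsmall Φ' hE' hstat hsub hnn)
    (fun hlarge hsub => hkin t ht₃ N hN₃ L hL hNL₃ n hn hwin s hs hlarge Φ' hE' hstat hsub)
  linarith

/-- **The composition**: the five stubs imply the crux BY NAME — `body_of_ineqs` with the regime inequalities
taken from S2 and, according as `v` is bounded or not, from S3a (no truncation needed: `v_t = v` for
`t ≥ ⌈B⌉`) or S3b. -/
theorem DensityResponse_of :
    TransportStationary → ConstitutiveCore → KineticSignCoherenceBounded →
      KineticSignCoherenceUnbounded → TruncationLimit →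
        BECThomsonPrinciple.DensityResponse := by
  intro h₁ h₂ h₃ h₃' h₄ v hv M hM
  obtain ⟨ρ₂, κ, C₁, hρ₂, hκ, -, N₂, t₂, hcore⟩ := h₂ v hv M hM
  by_cases hb : ∃ B : ℝ, ∀ r, v r ≤ ENNReal.ofReal B
  · obtain ⟨ρ₃, C', hρ₃, -, N₃, hkin⟩ := h₃ v hv hb M hM
    obtain ⟨B, hB⟩ := hb
    refine body_of_ineqs h₁ h₄ hv hρ₂ hκ hρ₃ hcore (C' := C') (N₃ := N₃) (t₃ := ⌈B⌉₊) fun t ht => ?_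
    rw [truncPotential_eq_self_of_le hB (Nat.ceil_le.mp ht)]
    exact hkin
  · have hub : ∀ B : ℝ, ∃ r, ENNReal.ofReal B < v r := by
      intro B
      by_contra h
      push Not at h
      exact hb ⟨B, h⟩
    obtain ⟨ρ₃, C', hρ₃, -, N₃, t₃, hkin⟩ := h₃' v hv hub M hM
    exact body_of_ineqs h₁ h₄ hv hρ₂ hκ hρ₃ hcore hkin

/-- **Registered sub-goal `stub_reduction`: the crux modulo its two open stubs.** With S1 (`stub_transportStationary`),
S3a and S3b (`stub_kineticSignCoherenceBounded/Unbounded`) PROVED in the tree, the crux `DensityResponse` follows from the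
constitutive core S2 (`ConstitutiveCore`, the open thermodynamic-limit compressibility content) and the truncation limit S4
(`TruncationLimit`, itself reduced to the maximal-form bound by the sibling line's `truncationLimit_of_maxFormBound`). [folklore] -/
theorem stub_reduction : ConstitutiveCore → TruncationLimit → BECThomsonPrinciple.DensityResponse :=
  fun h₂ h₄ => DensityResponse_of stub_transportStationary h₂ stub_kineticSignCoherenceBounded
    stub_kineticSignCoherenceUnbounded h₄

end

end Summit.AtomisticToContinuum.BoseEinsteinCondensation.Cruxes.DensityResponse.ForceBalanceConstitutive
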